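import Summits.ABC.StewartYu.PadicG3SchedS2
import HarnessLib

/-!
# Cell abc-stewartyu, crux `Y07Odd` (stmt-ABC-19658), line `gen3-slab-odd`: the record schedules with a FREE BOX SCALE `b ≥ 1`
# (`Lbox := LV/b`, resp. `L/b`; side `⌊Lbox/(2Aⱼ)⌋` = print box at `b = 1`, the former `/4` box at `b = 2`): the Siegel count wants a big box,
# the Kummer half-step (monomial denominators `∝ Σ sideⱼ·h(αⱼ)`) a small one — the record chooses `b` (numerics HOME/p2/AUDIT-IneqPackR.md)

`Summits/ABC/StewartYu/PadicG3SchedB.lean` — cell `abc-stewartyu` (seat p2-g4, F-odd lead).  Definitions `PadicG3Par.schedVb P b`, `PadicG3Par.sched1b P b`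
(the instances `schedV`/`sched1` with `Lbox` divided by `b`), rfl field lemmas, and their END sizing `endSizingVb` / `endSizing1b` (`Nq ≥ 2`, `b ≥ 1`:
the output box only shrinks).  No named fact.

References: Yu. V. Nesterenko, LNM 1819 (2003) §3.4, §5.
-/

noncomputable section

open Finset
open Literature.NumberTheory.Transcendental

namespace Summit.ABC.StewartYu

namespace PadicG3Par

variable {n : ℕ} (P : PadicG3Par n) (b : ℝ)

/-- The `m = 0` schedule with box scale `LV/b`. [folklore] -/
def schedVb : G3Sched n := { P.schedV with Lbox := (P.LV : ℝ) / b }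

/-- The `m ≥ 1` schedule with box scale `L/b`. [folklore] -/
def sched1b : G3Sched n := { P.sched1 with Lbox := (P.L : ℝ) / b }

/-- field. [folklore] -/ theorem schedVb_Lbox : (P.schedVb b).Lbox = (P.LV : ℝ) / b := rfl
/-- field. [folklore] -/ theorem schedVb_m : (P.schedVb b).m = P.m := rfl
/-- field. [folklore] -/ theorem schedVb_A : (P.schedVb b).A = P.A := rfl
/-- field. [folklore] -/ theorem schedVb_L₀ : (P.schedVb b).L₀ = P.L0V := rfl
/-- field. [folklore] -/ theorem schedVb_H : (P.schedVb b).H = P.HV := rfl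
/-- field. [folklore] -/ theorem schedVb_Sd : (P.schedVb b).Sd = P.SdG := rfl
/-- field. [folklore] -/ theorem schedVb_Xs : (P.schedVb b).Xs = P.XsV := rfl
/-- field. [folklore] -/ theorem schedVb_T : (P.schedVb b).T = P.TV := rfl
/-- field. [folklore] -/ theorem schedVb_Mord : (P.schedVb b).Mord = P.MordV := rfl
/-- field. [folklore] -/ theorem sched1b_Lbox : (P.sched1b b).Lbox = (P.L : ℝ) / b := rfl
/-- field. [folklore] -/ theorem sched1b_m : (P.sched1b b).m = P.m := rfl
/-- field. [folklore] -/ theorem sched1b_A : (P.sched1b b).A = P.A := rfl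
/-- field. [folklore] -/ theorem sched1b_L₀ : (P.sched1b b).L₀ = P.L₀ := rfl
/-- field. [folklore] -/ theorem sched1b_H : (P.sched1b b).H = P.H := rfl
/-- field. [folklore] -/ theorem sched1b_Sd : (P.sched1b b).Sd = P.Sdepth := rfl
/-- field. [folklore] -/ theorem sched1b_Xs : (P.sched1b b).Xs = P.Xs := rfl
/-- field. [folklore] -/ theorem sched1b_T : (P.sched1b b).T = P.T := rfl
/-- field. [folklore] -/ theorem sched1b_Mord : (P.sched1b b).Mord = P.Mord := rfl

end PadicG3Par

namespace G3Setup

variable {p : ℕ} [Fact p.Prime] (S : G3Setup p) (P : PadicG3Par S.n)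

omit [Fact p.Prime] S in
/-- Floor monotonicity for the output box: `⌊Nq·(L/b)/(2^Sd A)⌋ ≤ ⌊Nq·L/(2^Sd A)⌋` for `b ≥ 1`. [folklore] -/
theorem floor_div_le_floor {Nq : ℕ} {L b A : ℝ} (hL : 0 ≤ L) (hb : 1 ≤ b) (hA : 0 < A) (Sd : ℕ) :
    ⌊(Nq : ℝ) * (L / b) / (2 ^ Sd * A)⌋₊ ≤ ⌊(Nq : ℝ) * L / (2 ^ Sd * A)⌋₊ := by
  refine Nat.floor_le_floor ?_
  have hLb : L / b ≤ L := div_le_self hL hb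
  have : (Nq : ℝ) * (L / b) ≤ (Nq : ℝ) * L := mul_le_mul_of_nonneg_left hLb (Nat.cast_nonneg _)
  exact div_le_div_of_nonneg_right this (by positivity)

/-- **END sizing of the `m = 0` branch with box scale `b ≥ 1`**, `Nq ≥ 2`. [cite: Nesterenko2003, §5; shape only] -/
theorem endSizingVb (hNq : 2 ≤ P.Nq) {b : ℝ} (hb : 1 ≤ b) :
    2 * ((S.n + 1) * S.XfinOS (P.schedVb b)) ≤ S.NS (P.schedVb b) (P.schedVb b).Sd S.n ∧
    (S.n + 1) * P.S0NV < S.TordS (P.schedVb b) (P.schedVb b).Sd S.n ∧ (P.schedVb b).L₀ ≤ P.D0V ∧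
    ∀ j, 2 * S.Lb (S.sideS₂ (P.schedVb b)) (P.schedVb b).Sd j ≤ P.DV j := by
  obtain ⟨h1, h2, h3, _⟩ := S.endSizingV P
  refine ⟨h1, h2, h3, fun j => ?_⟩
  have hb0 : 0 < b := lt_of_lt_of_le zero_lt_one hb
  have h := S.two_mul_Lb_sideS₂_le (P.schedVb b) hNq (by show (0 : ℝ) ≤ (P.LV : ℝ) / b; positivity) j
  refine h.trans ?_
  show ⌊(P.Nq : ℝ) * ((P.LV : ℝ) / b) / (2 ^ P.SdG * P.A j)⌋₊ + 1 ≤ P.DV j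
  unfold PadicG3Par.DV
  exact Nat.add_le_add_right (floor_div_le_floor (by positivity) hb (P.A_pos j) P.SdG) 1

/-- **END sizing of the `m ≥ 1` branch with box scale `b ≥ 1`**, `Nq ≥ 2`. [cite: Nesterenko2003, §5; shape only] -/
theorem endSizing1b (hNq : 2 ≤ P.Nq) {b : ℝ} (hb : 1 ≤ b) :
    2 * ((S.n + 1) * S.XfinOS (P.sched1b b)) ≤ S.NS (P.sched1b b) (P.sched1b b).Sd S.n ∧
    (S.n + 1) * P.S₀N < S.TordS (P.sched1b b) (P.sched1b b).Sd S.n ∧ (P.sched1b b).L₀ ≤ P.D₀ ∧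
    ∀ j, 2 * S.Lb (S.sideS₂ (P.sched1b b)) (P.sched1b b).Sd j ≤ P.D j := by
  obtain ⟨h1, h2, h3, _⟩ := S.endSizing1 P
  refine ⟨h1, h2, h3, fun j => ?_⟩
  have hb0 : 0 < b := lt_of_lt_of_le zero_lt_one hb
  have h := S.two_mul_Lb_sideS₂_le (P.sched1b b) hNq (by show (0 : ℝ) ≤ (P.L : ℝ) / b; positivity) j
  refine h.trans ?_
  show ⌊(P.Nq : ℝ) * ((P.L : ℝ) / b) / (2 ^ P.Sdepth * P.A j)⌋₊ + 1 ≤ P.D j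
  unfold PadicG3Par.D
  exact Nat.add_le_add_right (floor_div_le_floor (by positivity) hb (P.A_pos j) P.Sdepth) 1

end G3Setup

end Summit.ABC.StewartYu

end
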